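import Summits.ValiantsHypothesis.ValiantsHypothesis.Theorems.SymPencilPerFourPeeledTZ

/-!
# Route `SymPencil` — inner rank of the `2 | 2` row split of `per_4`, PEELED case: the
# TWO-PENCIL FRAME ENGINE, part 1 — KEY and the Schur minor
# (`--supports` stmt-ValiantsHypothesis-5674 `SdcSuperquadratic`; (8,8) column of the size tables,
# memo `NOTE-p8g15-5674-R2-two-pencil.md` §2; rung currency only)

Pure matrix algebra behind the two-pencil frame lemma (the engine itself is
`…PeeledTwoPencil.twelve_le_card_of_gram`).

* `key_eq_zero` / `key_eq_zero_pencil` (**KEY**): an alternating `A` with all `2 × 2` minors of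
  `A Σ - Σᵀ A` vanishing is zero as soon as `Σ` has an eigenbasis with pairwise distinct
  eigenvalues (the diagonal of `A Σ - Σᵀ A` vanishes on eigenvectors; a symmetric matrix of rank
  `≤ 1` isotropic on a basis is `0` (`eq_zero_of_minors_of_isotropic_basis`); then
  Taussky–Zassenhaus `…PeeledTZ.eq_zero_of_eigen`).
* `exists_minor`: with `W₀ P₀₀ = 1`, symmetric `P`'s, generalised eigen-data for the pencil
  `(P₀₀, P₁₀)` with pairwise distinct eigenvalues and `Q = P₁₁ - P₁₀ W₀ P₀₁ ≠ 0`, the Schur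
  complement of the doubled two-pencil Gram matrix,
  `S = [[A W₀ P₁₀ - P₁₀ W₀ A, A W₀ A' - P₁₀ W₀ P₀₁ + P₁₁], [-P₀₁ W₀ P₁₀ + A' W₀ A + P₁₁, -P₀₁ W₀ A' + A' W₀ P₀₁]]`,
  has a non-zero `2 × 2` minor for ALL alternating `A` and all `A'` (if `A ≠ 0` inside the block
  `A Σ - Σᵀ A` by KEY, if `A = 0` the minor `-Q_{ij}²`).

Honest framing: helper lemmas; no cell closes here; the window `27 ≤ sdc(per_4) ≤ 29`, the crux
`SdcSuperquadratic` and `VP ≠ VNP` are untouched.  No definitions, no named facts. [folklore]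
-/

noncomputable section

-- single-conjunct layout: Sub = Summit, duplicated namespace component intended
set_option linter.dupNamespace false

namespace Summit.ValiantsHypothesis.ValiantsHypothesis.Theorems.SymPencilPerFourPeeledTwoPencilKey

open Matrix Finset Module
open Summit.ValiantsHypothesis.ValiantsHypothesis.Theorems.SymPencilPerFourPeeledTZ

universe u

variable {K : Type u} [Field K]

/-! ### KEY: an alternating `A` with `rank (A Σ - Σᵀ A) ≤ 1` vanishes when `Σ` has an eigenbasis
with pairwise distinct eigenvalues -/

/-- `B = A Σ - Σᵀ A` is symmetric for an alternating `A`. [folklore] -/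
theorem transpose_comm_eq {n : Type*} [Fintype n] (A S : Matrix n n K) (hA : Aᵀ = -A) :
    (A * S - Sᵀ * A)ᵀ = A * S - Sᵀ * A := by
  rw [transpose_sub, transpose_mul, transpose_mul, transpose_transpose, hA, Matrix.neg_mul,
    Matrix.mul_neg, sub_neg_eq_add, neg_add_eq_sub]

/-- `B = A Σ - Σᵀ A` is isotropic on every eigenvector of `Σ` (characteristic `0`). [folklore] -/
theorem eigen_isotropic [CharZero K] {n : Type*} [Fintype n] (A S : Matrix n n K) (hA : Aᵀ = -A)
    (w : n → K) (s : K) (hw : S *ᵥ w = s • w) :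
    w ⬝ᵥ (A * S - Sᵀ * A) *ᵥ w = 0 := by
  have h0 : w ⬝ᵥ A *ᵥ w = 0 := by
    have h := dot_mulVec_antisymm A hA w w
    have h2 : (2 : K) * (w ⬝ᵥ A *ᵥ w) = 0 := by linear_combination h
    exact (mul_eq_zero.1 h2).resolve_left two_ne_zero
  have h1 : w ⬝ᵥ (A * S) *ᵥ w = 0 := by
    rw [← mulVec_mulVec, hw, mulVec_smul, dotProduct_smul, h0, smul_zero]
  have h2 : w ⬝ᵥ (Sᵀ * A) *ᵥ w = 0 := by
    rw [← mulVec_mulVec, dotProduct_mulVec, vecMul_transpose, hw, smul_dotProduct, h0, smul_zero]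
  rw [Matrix.sub_mulVec, dotProduct_sub, h1, h2, sub_zero]

/-- A symmetric matrix all of whose `2 × 2` minors vanish and which is isotropic on the rows of an
invertible matrix is zero. [folklore] -/
theorem eq_zero_of_minors_of_isotropic_basis {n : Type*} [Fintype n] [DecidableEq n]
    (B : Matrix n n K) (hB : Bᵀ = B)
    (hmin : ∀ i j k l, B i k * B j l - B i l * B j k = 0)
    (v : n → n → K) (W : Matrix n n K) (hW : W * Matrix.of v = 1)
    (hiso : ∀ j, v j ⬝ᵥ B *ᵥ v j = 0) : B = 0 := by
  by_contra hne
  -- a non-zero entry, and then a non-zero diagonal entry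
  obtain ⟨p, q, hpq⟩ : ∃ p q, B p q ≠ 0 := by
    by_contra h
    push Not at h
    exact hne (Matrix.ext fun i j => by rw [h i j, Matrix.zero_apply])
  have hqp : B q p = B p q := by
    have h := congr_fun (congr_fun hB q) p
    rw [transpose_apply] at h
    exact h.symm
  have hpp : B p p ≠ 0 := by
    intro h0
    have h := hmin p q p q
    rw [h0, zero_mul, zero_sub, neg_eq_zero, hqp] at h
    exact hpq (pow_eq_zero_iff two_ne_zero |>.1 (by rw [pow_two]; exact h))
  -- every entry factors through row `p`
  have hfac : ∀ i k, B i k = B p i * B p k / B p p := by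
    intro i k
    have h := hmin i p k p
    have hip : B i p = B p i := by
      have h' := congr_fun (congr_fun hB i) p
      rw [transpose_apply] at h'
      exact h'.symm
    rw [eq_div_iff hpp, ← hip]
    linear_combination h
  -- the quadratic form is a square
  set u : n → K := fun k => B p k with hu
  have hsq : ∀ x : n → K, x ⬝ᵥ B *ᵥ x = (u ⬝ᵥ x) * (u ⬝ᵥ x) / B p p := by
    intro x
    simp only [dotProduct, mulVec, hu]
    rw [Finset.sum_mul_sum, Finset.sum_div]
    refine Finset.sum_congr rfl fun i _ => ?_
    rw [Finset.mul_sum, Finset.sum_div]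
    refine Finset.sum_congr rfl fun k _ => ?_
    rw [hfac i k]; ring
  have hux : ∀ j, u ⬝ᵥ v j = 0 := by
    intro j
    have h := hiso j
    rw [hsq, div_eq_zero_iff] at h
    rcases h with h | h
    · exact mul_self_eq_zero.1 h
    · exact absurd h hpp
  -- `u` is orthogonal to a basis, hence zero
  have hvu : Matrix.of v *ᵥ u = 0 := by
    funext j
    rw [Pi.zero_apply]
    change (fun k => v j k) ⬝ᵥ u = 0
    rw [dotProduct_comm]; exact hux j
  have hu0 : u = 0 := by
    have : (W * Matrix.of v) *ᵥ u = 0 := by rw [← mulVec_mulVec, hvu, mulVec_zero]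
    rwa [hW, one_mulVec] at this
  exact hpp (by have := congr_fun hu0 p; simpa [hu] using this)

/-- **KEY.**  Let `A` be alternating and `Σ` have an eigenbasis `v` (rows of an invertible matrix)
with pairwise distinct eigenvalues.  If all `2 × 2` minors of `A Σ - Σᵀ A` vanish (rank `≤ 1`),
then `A = 0` (characteristic `0`). [folklore] -/
theorem key_eq_zero [CharZero K] {n : Type*} [Fintype n] [DecidableEq n]
    (A S : Matrix n n K) (hA : Aᵀ = -A)
    (v : n → n → K) (s : n → K) (hv : ∀ j, S *ᵥ v j = s j • v j)
    (hs : ∀ i j, i ≠ j → s i ≠ s j) (W : Matrix n n K) (hW : W * Matrix.of v = 1)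
    (hmin : ∀ i j k l, (A * S - Sᵀ * A) i k * (A * S - Sᵀ * A) j l -
      (A * S - Sᵀ * A) i l * (A * S - Sᵀ * A) j k = 0) : A = 0 := by
  have hB0 : A * S - Sᵀ * A = 0 :=
    eq_zero_of_minors_of_isotropic_basis _ (transpose_comm_eq A S hA) hmin v W hW
      (fun j => eigen_isotropic A S hA (v j) (s j) (hv j))
  exact eq_zero_of_eigen A S hA (sub_eq_zero.1 hB0) v s hv hs W hW

/-- **KEY, pencil form**: `Σ = W₀ P₁` with `W₀ P₀ = 1` and generalised eigen-data
`P₁ v_j = s_j P₀ v_j`. [folklore] -/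
theorem key_eq_zero_pencil [CharZero K] {n : Type*} [Fintype n] [DecidableEq n]
    (A P₀ P₁ W₀ : Matrix n n K) (hA : Aᵀ = -A) (hW₀ : W₀ * P₀ = 1)
    (v : n → n → K) (s : n → K) (hv : ∀ j, P₁ *ᵥ v j = s j • P₀ *ᵥ v j)
    (hs : ∀ i j, i ≠ j → s i ≠ s j) (W : Matrix n n K) (hW : W * Matrix.of v = 1)
    (hmin : ∀ i j k l, (A * (W₀ * P₁) - (W₀ * P₁)ᵀ * A) i k * (A * (W₀ * P₁) - (W₀ * P₁)ᵀ * A) j l -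
      (A * (W₀ * P₁) - (W₀ * P₁)ᵀ * A) i l * (A * (W₀ * P₁) - (W₀ * P₁)ᵀ * A) j k = 0) :
    A = 0 := by
  refine key_eq_zero A (W₀ * P₁) hA v s (fun j => ?_) hs W hW hmin
  rw [← mulVec_mulVec, hv j, mulVec_smul, mulVec_mulVec, hW₀, one_mulVec]


/-! ### The Schur rows: a non-zero `2 × 2` minor of the Schur complement from KEY or from `Q ≠ 0` -/

/-- **Minor dichotomy.**  For the Schur complement
`S = [[A W₀ P₁₀ - P₁₀ W₀ A, A W₀ A' - P₁₀ W₀ P₀₁ + P₁₁], [-P₀₁ W₀ P₁₀ + A' W₀ A + P₁₁, -P₀₁ W₀ A' + A' W₀ P₀₁]]`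
of the doubled two-pencil Gram matrix: if KEY holds for the pencil `W₀ P₁₀` (eigen-data) and
`Q = P₁₁ - P₁₀ W₀ P₀₁ ≠ 0`, then `S` has a non-zero `2 × 2` minor, whatever the alternating `A, A'`.
[folklore] -/
theorem exists_minor [CharZero K] (A A' P₀₀ P₁₀ P₀₁ P₁₁ W₀ : Matrix (Fin 4) (Fin 4) K)
    (hA : Aᵀ = -A) (hP₀₀ : P₀₀ᵀ = P₀₀) (hP₁₀ : P₁₀ᵀ = P₁₀) (hP₀₁ : P₀₁ᵀ = P₀₁) (hP₁₁ : P₁₁ᵀ = P₁₁)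
    (hW₀ : W₀ * P₀₀ = 1)
    (v : Fin 4 → Fin 4 → K) (s : Fin 4 → K) (hv : ∀ j, P₁₀ *ᵥ v j = s j • P₀₀ *ᵥ v j)
    (hs : ∀ i j, i ≠ j → s i ≠ s j) (W : Matrix (Fin 4) (Fin 4) K) (hW : W * Matrix.of v = 1)
    (hQ : P₁₁ - P₁₀ * W₀ * P₀₁ ≠ 0) :
    ∃ ρ₁ ρ₂ γ₁ γ₂ : Fin 4 ⊕ Fin 4,
      (Matrix.fromBlocks (A * W₀ * P₁₀ - P₁₀ * W₀ * A) (A * W₀ * A' - P₁₀ * W₀ * P₀₁ + P₁₁)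
          (-(P₀₁ * W₀ * P₁₀) + A' * W₀ * A + P₁₁) (-(P₀₁ * W₀ * A') + A' * W₀ * P₀₁)) ρ₁ γ₁ *
        (Matrix.fromBlocks (A * W₀ * P₁₀ - P₁₀ * W₀ * A) (A * W₀ * A' - P₁₀ * W₀ * P₀₁ + P₁₁)
          (-(P₀₁ * W₀ * P₁₀) + A' * W₀ * A + P₁₁) (-(P₀₁ * W₀ * A') + A' * W₀ * P₀₁)) ρ₂ γ₂ -
      (Matrix.fromBlocks (A * W₀ * P₁₀ - P₁₀ * W₀ * A) (A * W₀ * A' - P₁₀ * W₀ * P₀₁ + P₁₁)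
          (-(P₀₁ * W₀ * P₁₀) + A' * W₀ * A + P₁₁) (-(P₀₁ * W₀ * A') + A' * W₀ * P₀₁)) ρ₁ γ₂ *
        (Matrix.fromBlocks (A * W₀ * P₁₀ - P₁₀ * W₀ * A) (A * W₀ * A' - P₁₀ * W₀ * P₀₁ + P₁₁)
          (-(P₀₁ * W₀ * P₁₀) + A' * W₀ * A + P₁₁) (-(P₀₁ * W₀ * A') + A' * W₀ * P₀₁)) ρ₂ γ₁ ≠ 0 := by
  set S₁₁ := A * W₀ * P₁₀ - P₁₀ * W₀ * A with hS₁₁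
  set S₁₂ := A * W₀ * A' - P₁₀ * W₀ * P₀₁ + P₁₁ with hS₁₂
  set S₂₁ := -(P₀₁ * W₀ * P₁₀) + A' * W₀ * A + P₁₁ with hS₂₁
  set S₂₂ := -(P₀₁ * W₀ * A') + A' * W₀ * P₀₁ with hS₂₂
  -- `W₀ = P₀₀⁻¹` is symmetric
  have hW₀' : P₀₀ * W₀ = 1 := mul_eq_one_comm.1 hW₀
  have hW0t : W₀ᵀ = W₀ := by
    have h1 : W₀ᵀ * P₀₀ = 1 := by
      have := congr_arg Matrix.transpose hW₀'
      rwa [transpose_mul, transpose_one, hP₀₀] at this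
    calc W₀ᵀ = W₀ᵀ * (P₀₀ * W₀) := by rw [hW₀', Matrix.mul_one]
      _ = (W₀ᵀ * P₀₀) * W₀ := by rw [Matrix.mul_assoc]
      _ = W₀ := by rw [h1, Matrix.one_mul]
  by_cases hA0 : A = 0
  · -- `A = 0`: the minor on rows `(n¹ i, m¹ j)`, columns `(r i, w j)` is `-Q_{ij}²`
    obtain ⟨i, j, hij⟩ : ∃ i j, (P₁₁ - P₁₀ * W₀ * P₀₁) i j ≠ 0 := by
      by_contra h
      push Not at h
      exact hQ (Matrix.ext fun i j => by rw [h i j]; rfl)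
    refine ⟨Sum.inl i, Sum.inr j, Sum.inl i, Sum.inr j, ?_⟩
    have e11 : S₁₁ i i = 0 := by simp [hS₁₁, hA0]
    have e12 : S₁₂ i j = (P₁₁ - P₁₀ * W₀ * P₀₁) i j := by
      simp [hS₁₂, hA0, Matrix.sub_apply, Matrix.add_apply]; ring
    have e21 : S₂₁ j i = (P₁₁ - P₁₀ * W₀ * P₀₁) i j := by
      have ht : (P₀₁ * W₀ * P₁₀)ᵀ = P₁₀ * W₀ * P₀₁ := by
        rw [transpose_mul, transpose_mul, hP₀₁, hW0t, hP₁₀, Matrix.mul_assoc]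
      have h1 : (P₀₁ * W₀ * P₁₀) j i = (P₁₀ * W₀ * P₀₁) i j := by
        rw [← ht, transpose_apply]
      have h2 : P₁₁ j i = P₁₁ i j := by
        conv_lhs => rw [← hP₁₁]
        rfl
      simp only [hS₂₁, hA0, Matrix.mul_zero, add_zero, Matrix.add_apply, Matrix.neg_apply,
        Matrix.sub_apply, h1, h2]
      ring
    simp only [Matrix.fromBlocks_apply₁₁, Matrix.fromBlocks_apply₁₂, Matrix.fromBlocks_apply₂₁,
      Matrix.fromBlocks_apply₂₂, e11, e12, e21, zero_mul, zero_sub, neg_ne_zero]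
    exact mul_ne_zero hij hij
  · -- `A ≠ 0`: KEY gives a non-zero minor inside `S₁₁`
    have hS : S₁₁ = A * (W₀ * P₁₀) - (W₀ * P₁₀)ᵀ * A := by
      rw [hS₁₁, transpose_mul, hP₁₀, hW0t, Matrix.mul_assoc]
    by_contra h
    push Not at h
    apply hA0
    refine key_eq_zero_pencil A P₀₀ P₁₀ W₀ hA hW₀ v s hv hs W hW (fun i j k l => ?_)
    have := h (Sum.inl i) (Sum.inl j) (Sum.inl k) (Sum.inl l)
    simp only [Matrix.fromBlocks_apply₁₁] at this
    rw [← hS]; exact this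


/-! ### A bookkeeping lemma for the engine -/

/-- Splitting a sum over the generator index `(Fin 4 × Fin 4) ⊕ Fin 2`. [folklore] -/
theorem sum_index_split {M : Type*} [AddCommMonoid M] (f : (Fin 4 × Fin 4) ⊕ Fin 2 → M) :
    ∑ j, f j = ∑ k : Fin 4, f (Sum.inl (0, k)) + ∑ k : Fin 4, f (Sum.inl (1, k)) +
      ∑ k : Fin 4, f (Sum.inl (2, k)) + ∑ k : Fin 4, f (Sum.inl (3, k)) +
      (f (Sum.inr 0) + f (Sum.inr 1)) := by
  rw [Fintype.sum_sum_type, Fintype.sum_prod_type, Fin.sum_univ_four, Fin.sum_univ_two]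

end Summit.ValiantsHypothesis.ValiantsHypothesis.Theorems.SymPencilPerFourPeeledTwoPencilKey

end
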